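import Literature.NumberTheory.Automorphic.OrbitalShellAverageLocallyConstant        -- ★ p844096 (this seat): shell averages of a locally constant `φ` freeze along continuous families
import Literature.NumberTheory.Rogawski1990.RankOneUnstableTransferNonsplitCoreFold        -- ★ p843587: the fold (tokens `cmDatum`, `LocalRing`, `IsRegularElt`, `IsLocSmooth`; the layer's carrier)
import HarnessLib

/-!
# R1LL-WILD (Ψ3) — THE WINDOW SUM `W` OF THE WILD SHELL LAW IS EVENTUALLY CONSTANT AT EVERY SINGULAR POINT OF THE TORUS
# (the `hW` binder of the (γ) layer `rankOneUnstable_core_of_shellWindow`, for the (W′-B6) contract's spelling of `W`)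

Topic `NumberTheory/Rogawski1990`; namespace `Literature.NumberTheory.Rogawski1990`.  THEOREMS ONLY (no definition, no instance, no notation, no named fact,
no `sorry`).  Cell `pub/hodgecm-mathlib` (D-0151), crux H413 = `stmt-HodgeConjecture-24833`; road «W′» = «R1LL-WILD»; architect A-p16 (g28) RULINGS A-37 (deal (Ψ3) →
B-p04 (g35)), A-43∕A-44 (consumer (W′-B6) F0P3-p01 (g14), CONTRACT v1 24e03b6f5d0fad13: «(Ψ3) B-p04 — `hW` for
`W t := Σ i ∈ Finset.range (j + R + 1), (2 * q ^ i : ℂ) * (Φ t i − ΦD t i)`; propose `W`'s Lean spelling and I adopt it byte-for-byte»).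

THE SPELLING (this seat, 12:03Z).  The (W′3) window values `Φ t i`, `ΦD t i` ARE shell averages of the test function at explicit group elements:
`Φ t i := ∫ k in ↑(K.prod ⊤), f (k⁻¹ * N i t * k) ∂ν`, `ΦD t i := ∫ k in ↑(K.prod ⊤), f (k⁻¹ * ND i t * k) ∂ν`, where the WINDOW FAMILIES
`N ND : ℕ → Z(t₀) → H_v` (binders; supplied by the (W′3)+ρ-dress hands p08 (g15) ∕ B-p08 (g28)) are the class-`1` resp. `D_u`-conjugate NORMAL FORMS of the conjugate
`rU(oβ t + i − j)⁻¹ · t · rU(oβ t + i − j)` at RELATIVE shell `i`, re-normalised inside `K` so that `t ↦ N i t` is CONTINUOUS AT EVERY SINGULAR `s` (the unit part of the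
window coordinate conjugated away by `diag(1, r∕b₁(t)) ∈ K`; [LabesseLanglands1979 §2 p. 9], [Labesse2024 Prop. 0.0.11 (B5): the substitution `η ↦ β₁⁻¹η`]).  So
`W t := ∑ i ∈ Finset.range (j + R + 1), (2 * (q : ℂ) ^ i) * ((∫ k in ↑(K.prod ⊤), f (k⁻¹ * N i t * k) ∂ν) - ∫ k in ↑(K.prod ⊤), f (k⁻¹ * ND i t * k) ∂ν)`.

THE THEOREM.  `f` locally constant (`IsLocSmooth`), `↑(K.prod ⊤)` compact and measurable, `N i`, `ND i` continuous at the singular points ⟹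
`hW : ∀ s, ¬ IsRegularElt s → ∀ᶠ t in 𝓝 s, t ∈ U → W t = W s` — VERBATIM the (γ) layer's binder (tube lemma ★ `Literature.Topology.eventually_forall_apply_eq_of_isLocallyConstant`
through ★ `eventually_setIntegral_conj_apply_eq_of_continuousAt`; no measure-theoretic hypothesis on `ν`, no integrability, any `q j R`).
* §1 `eventually_mem_imp_shellWindow_eq_of_continuousAt` — generic topological group `G`, parameter space `X`.
* §2 **`wildWindow_eventually_eq`** — the literal `H_v = U(Φ₂)_v × U(Φ₁)_v`, `Z(t₀)`, `IsRegularElt`, `IsLocSmooth` spelling of the layer.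

HONEST LABEL: HC_CM is proved only modulo the 2 remaining named inputs (hLiu418, h413) until rung 0 closes; this file is unconditional (topology of locally constant functions).

## References
* [LabesseLanglands1979] J.-P. Labesse, R. P. Langlands, *L-indistinguishability for SL(2)*, Canad. J. Math. 31 (1979): §2 pp. 8–9 (shells, window).
* [Labesse2024StabilisationGermesSL2] J.-P. Labesse, *Stabilisation des germes de SL(2)*, arXiv:2411.14820: Prop. 0.0.11, Th. 0.0.12 (pp. 7–8).
* [Rogawski1990] J. D. Rogawski, *Automorphic Representations of Unitary Groups in Three Variables* (1990): §4.9 Lemma 4.9.3.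
-/

set_option autoImplicit false

noncomputable section

open Set Filter Topology MeasureTheory NumberField IsDedekindDomain
open scoped Matrix MatrixGroups

namespace Literature.NumberTheory.Rogawski1990

open Literature.NumberTheory.Automorphic Literature.NumberTheory.Automorphic.UnitaryGroup Literature.NumberTheory.GaloisRepresentations

/-! ## §1 Generic group form -/

section Generic

variable {G : Type*} [Group G] [TopologicalSpace G] [IsTopologicalGroup G] [MeasurableSpace G]
variable {X : Type*} [TopologicalSpace X]

/-- **THE SHELL WINDOW FREEZES AT `s`** (generic group): `f` locally constant, `S` compact measurable, window families `N i`, `ND i` continuous AT `s` for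
`i` in the window; then for ANY guard `U`, `∀ᶠ t in 𝓝 s, t ∈ U → W t = W s` for
`W t = Σ_{i < j+R+1} 2q^i · (∫_S f(k⁻¹ N_i(t) k) − ∫_S f(k⁻¹ ND_i(t) k))`. [cite: LabesseLanglands1979, §2 p. 9] [cite: Labesse2024StabilisationGermesSL2, Prop. 0.0.11, Th. 0.0.12] -/
theorem eventually_mem_imp_shellWindow_eq_of_continuousAt (ν : Measure G) {f : G → ℂ} (hf : IsLocallyConstant f) {S : Set G} (hS : IsCompact S)
    (hSm : MeasurableSet S) (q j R : ℕ) {N ND : ℕ → X → G} {s : X}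
    (hN : ∀ i ∈ Finset.range (j + R + 1), ContinuousAt (N i) s) (hND : ∀ i ∈ Finset.range (j + R + 1), ContinuousAt (ND i) s) (U : Set X) :
    ∀ᶠ t in 𝓝 s, t ∈ U →
      (∑ i ∈ Finset.range (j + R + 1), (2 * (q : ℂ) ^ i) * ((∫ k in S, f (k⁻¹ * N i t * k) ∂ν) - ∫ k in S, f (k⁻¹ * ND i t * k) ∂ν)) =
        ∑ i ∈ Finset.range (j + R + 1), (2 * (q : ℂ) ^ i) * ((∫ k in S, f (k⁻¹ * N i s * k) ∂ν) - ∫ k in S, f (k⁻¹ * ND i s * k) ∂ν) := by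
  have h : ∀ i ∈ Finset.range (j + R + 1), ∀ᶠ t in 𝓝 s,
      (2 * (q : ℂ) ^ i) * ((∫ k in S, f (k⁻¹ * N i t * k) ∂ν) - ∫ k in S, f (k⁻¹ * ND i t * k) ∂ν) =
        (2 * (q : ℂ) ^ i) * ((∫ k in S, f (k⁻¹ * N i s * k) ∂ν) - ∫ k in S, f (k⁻¹ * ND i s * k) ∂ν) := fun i hi => by
    filter_upwards [eventually_setIntegral_conj_apply_eq_of_continuousAt ν hf hS hSm (hN i hi),
      eventually_setIntegral_conj_apply_eq_of_continuousAt ν hf hS hSm (hND i hi)] with t htN htD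
    rw [htN, htD]
  filter_upwards [((Finset.range (j + R + 1)).eventually_all).2 h] with t ht _
  exact Finset.sum_congr rfl fun i hi => ht i hi

/-- The same for families continuous everywhere: the window sum is LOCALLY CONSTANT on `X`. [cite: LabesseLanglands1979, §2 p. 9] -/
theorem isLocallyConstant_shellWindow (ν : Measure G) {f : G → ℂ} (hf : IsLocallyConstant f) {S : Set G} (hS : IsCompact S)
    (hSm : MeasurableSet S) (q j R : ℕ) {N ND : ℕ → X → G}
    (hN : ∀ i ∈ Finset.range (j + R + 1), Continuous (N i)) (hND : ∀ i ∈ Finset.range (j + R + 1), Continuous (ND i)) :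
    IsLocallyConstant fun t =>
      ∑ i ∈ Finset.range (j + R + 1), (2 * (q : ℂ) ^ i) * ((∫ k in S, f (k⁻¹ * N i t * k) ∂ν) - ∫ k in S, f (k⁻¹ * ND i t * k) ∂ν) :=
  (IsLocallyConstant.iff_eventually_eq _).2 fun _ =>
    (eventually_mem_imp_shellWindow_eq_of_continuousAt ν hf hS hSm q j R (fun i hi => (hN i hi).continuousAt)
      (fun i hi => (hND i hi).continuousAt) (Set.univ : Set X)).mono fun _ h => h (mem_univ _)

end Generic

/-! ## §2 The (γ) layer's `hW` binder, literal spelling -/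

section Layer

variable (L : Type) [Field L] [NumberField L] [IsCMField L] (v : HeightOneSpectrum (𝓞 ↥(maximalRealSubfield L)))

/-- **(Ψ3) `hW` — THE WILD WINDOW SUM IS EVENTUALLY CONSTANT AT EVERY SINGULAR POINT OF `Z(t₀)`.**  For the (W′-B6) contract's
`W t := ∑ i ∈ Finset.range (j + R + 1), (2 * (q : ℂ) ^ i) * ((∫ k in ↑(K.prod ⊤), f (k⁻¹ * N i t * k) ∂ν) - ∫ k in ↑(K.prod ⊤), f (k⁻¹ * ND i t * k) ∂ν)`
with `f` locally constant of compact support, `↑(K.prod ⊤)` compact and measurable, and window families `N i`, `ND i : Z(t₀) → H_v` continuous at the singular points: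
`∀ s, ¬ IsRegularElt s → ∀ᶠ t in 𝓝 s, t ∈ {regular} → W t = W s` — the binder `hW` of `rankOneUnstable_core_of_shellWindow` verbatim.
[cite: LabesseLanglands1979, §2 p. 9] [cite: Labesse2024StabilisationGermesSL2, Prop. 0.0.11, Th. 0.0.12] [cite: Rogawski1990, §4.9 Lemma 4.9.3] -/
theorem wildWindow_eventually_eq
    [MeasurableSpace ((cmDatum L 2 (Matrix.of fun i j : Fin 2 => if i.val + j.val + 1 = 2 then (1 : L) else 0)).Local v × (cmDatum L 1 (Matrix.of fun i j : Fin 1 => if i.val + j.val + 1 = 1 then (1 : L) else 0)).Local v)] [BorelSpace ((cmDatum L 2 (Matrix.of fun i j : Fin 2 => if i.val + j.val + 1 = 2 then (1 : L) else 0)).Local v × (cmDatum L 1 (Matrix.of fun i j : Fin 1 => if i.val + j.val + 1 = 1 then (1 : L) else 0)).Local v)] (ν : Measure ((cmDatum L 2 (Matrix.of fun i j : Fin 2 => if i.val + j.val + 1 = 2 then (1 : L) else 0)).Local v × (cmDatum L 1 (Matrix.of fun i j : Fin 1 => if i.val + j.val + 1 = 1 then (1 : L) else 0)).Local v))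
    (f : ((cmDatum L 2 (Matrix.of fun i j : Fin 2 => if i.val + j.val + 1 = 2 then (1 : L) else 0)).Local v × (cmDatum L 1 (Matrix.of fun i j : Fin 1 => if i.val + j.val + 1 = 1 then (1 : L) else 0)).Local v) → ℂ) (hf : IsLocSmooth f) (t₀ : ((cmDatum L 2 (Matrix.of fun i j : Fin 2 => if i.val + j.val + 1 = 2 then (1 : L) else 0)).Local v × (cmDatum L 1 (Matrix.of fun i j : Fin 1 => if i.val + j.val + 1 = 1 then (1 : L) else 0)).Local v))
    (K : Subgroup ((cmDatum L 2 (Matrix.of fun i j : Fin 2 => if i.val + j.val + 1 = 2 then (1 : L) else 0)).Local v))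
    (hKc : IsCompact ((K.prod (⊤ : Subgroup ((cmDatum L 1 (Matrix.of fun i j : Fin 1 => if i.val + j.val + 1 = 1 then (1 : L) else 0)).Local v)) : Subgroup ((cmDatum L 2 (Matrix.of fun i j : Fin 2 => if i.val + j.val + 1 = 2 then (1 : L) else 0)).Local v × (cmDatum L 1 (Matrix.of fun i j : Fin 1 => if i.val + j.val + 1 = 1 then (1 : L) else 0)).Local v)) : Set ((cmDatum L 2 (Matrix.of fun i j : Fin 2 => if i.val + j.val + 1 = 2 then (1 : L) else 0)).Local v × (cmDatum L 1 (Matrix.of fun i j : Fin 1 => if i.val + j.val + 1 = 1 then (1 : L) else 0)).Local v)))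
    (hKm : MeasurableSet ((K.prod (⊤ : Subgroup ((cmDatum L 1 (Matrix.of fun i j : Fin 1 => if i.val + j.val + 1 = 1 then (1 : L) else 0)).Local v)) : Subgroup ((cmDatum L 2 (Matrix.of fun i j : Fin 2 => if i.val + j.val + 1 = 2 then (1 : L) else 0)).Local v × (cmDatum L 1 (Matrix.of fun i j : Fin 1 => if i.val + j.val + 1 = 1 then (1 : L) else 0)).Local v)) : Set ((cmDatum L 2 (Matrix.of fun i j : Fin 2 => if i.val + j.val + 1 = 2 then (1 : L) else 0)).Local v × (cmDatum L 1 (Matrix.of fun i j : Fin 1 => if i.val + j.val + 1 = 1 then (1 : L) else 0)).Local v)))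
    (q j R : ℕ) (N ND : ℕ → ↥(Subgroup.centralizer ({t₀} : Set ((cmDatum L 2 (Matrix.of fun i j : Fin 2 => if i.val + j.val + 1 = 2 then (1 : L) else 0)).Local v × (cmDatum L 1 (Matrix.of fun i j : Fin 1 => if i.val + j.val + 1 = 1 then (1 : L) else 0)).Local v))) → ((cmDatum L 2 (Matrix.of fun i j : Fin 2 => if i.val + j.val + 1 = 2 then (1 : L) else 0)).Local v × (cmDatum L 1 (Matrix.of fun i j : Fin 1 => if i.val + j.val + 1 = 1 then (1 : L) else 0)).Local v))
    (hN : ∀ i ∈ Finset.range (j + R + 1), ∀ s : ↥(Subgroup.centralizer ({t₀} : Set ((cmDatum L 2 (Matrix.of fun i j : Fin 2 => if i.val + j.val + 1 = 2 then (1 : L) else 0)).Local v × (cmDatum L 1 (Matrix.of fun i j : Fin 1 => if i.val + j.val + 1 = 1 then (1 : L) else 0)).Local v))), ¬ IsRegularElt ((s : ((cmDatum L 2 (Matrix.of fun i j : Fin 2 => if i.val + j.val + 1 = 2 then (1 : L) else 0)).Local v × (cmDatum L 1 (Matrix.of fun i j : Fin 1 => if i.val + j.val + 1 = 1 then (1 :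 L) else 0)).Local v)).1.val : GL (Fin 2) (LocalRing L v)) → ContinuousAt (N i) s)
    (hND : ∀ i ∈ Finset.range (j + R + 1), ∀ s : ↥(Subgroup.centralizer ({t₀} : Set ((cmDatum L 2 (Matrix.of fun i j : Fin 2 => if i.val + j.val + 1 = 2 then (1 : L) else 0)).Local v × (cmDatum L 1 (Matrix.of fun i j : Fin 1 => if i.val + j.val + 1 = 1 then (1 : L) else 0)).Local v))), ¬ IsRegularElt ((s : ((cmDatum L 2 (Matrix.of fun i j : Fin 2 => if i.val + j.val + 1 = 2 then (1 : L) else 0)).Local v × (cmDatum L 1 (Matrix.of fun i j : Fin 1 => if i.val + j.val + 1 = 1 then (1 : L) else 0)).Local v)).1.val : GL (Fin 2) (LocalRing L v)) → ContinuousAt (ND i) s) :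
    ∀ s : ↥(Subgroup.centralizer ({t₀} : Set ((cmDatum L 2 (Matrix.of fun i j : Fin 2 => if i.val + j.val + 1 = 2 then (1 : L) else 0)).Local v × (cmDatum L 1 (Matrix.of fun i j : Fin 1 => if i.val + j.val + 1 = 1 then (1 : L) else 0)).Local v))), ¬ IsRegularElt ((s : ((cmDatum L 2 (Matrix.of fun i j : Fin 2 => if i.val + j.val + 1 = 2 then (1 : L) else 0)).Local v × (cmDatum L 1 (Matrix.of fun i j : Fin 1 => if i.val + j.val + 1 = 1 then (1 : L) else 0)).Local v)).1.val : GL (Fin 2) (LocalRing L v)) →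
      ∀ᶠ (t : ↥(Subgroup.centralizer ({t₀} : Set ((cmDatum L 2 (Matrix.of fun i j : Fin 2 => if i.val + j.val + 1 = 2 then (1 : L) else 0)).Local v × (cmDatum L 1 (Matrix.of fun i j : Fin 1 => if i.val + j.val + 1 = 1 then (1 : L) else 0)).Local v)))) in 𝓝 s, t ∈ {t : ↥(Subgroup.centralizer ({t₀} : Set ((cmDatum L 2 (Matrix.of fun i j : Fin 2 => if i.val + j.val + 1 = 2 then (1 : L) else 0)).Local v × (cmDatum L 1 (Matrix.of fun i j : Fin 1 => if i.val + j.val + 1 = 1 then (1 : L) else 0)).Local v))) | IsRegularElt ((t : ((cmDatum L 2 (Matrix.of fun i j : Fin 2 => if i.val + j.val + 1 = 2 then (1 : L) else 0)).Local v × (cmDatum L 1 (Matrix.of fun i j : Fin 1 => if i.val + j.val + 1 = 1 then (1 : L) else 0)).Local v)).1.val : GL (Fin 2) (LocalRing L v))} →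
        (∑ i ∈ Finset.range (j + R + 1), (2 * (q : ℂ) ^ i) * ((∫ k in ((K.prod (⊤ : Subgroup ((cmDatum L 1 (Matrix.of fun i j : Fin 1 => if i.val + j.val + 1 = 1 then (1 : L) else 0)).Local v)) : Subgroup ((cmDatum L 2 (Matrix.of fun i j : Fin 2 => if i.val + j.val + 1 = 2 then (1 : L) else 0)).Local v × (cmDatum L 1 (Matrix.of fun i j : Fin 1 => if i.val + j.val + 1 = 1 then (1 : L) else 0)).Local v)) : Set ((cmDatum L 2 (Matrix.of fun i j : Fin 2 => if i.val + j.val + 1 = 2 then (1 : L) else 0)).Local v × (cmDatum L 1 (Matrix.of fun i j : Fin 1 => if i.val + j.val + 1 = 1 then (1 : L) else 0)).Local v)), f (k⁻¹ * N i t * k) ∂ν) - ∫ k in ((K.prod (⊤ : Subgroup ((cmDatum L 1 (Matrix.of fun i j : Fin 1 => if i.val + j.val + 1 = 1 then (1 : L) else 0)).Local v)) : Subgroup ((cmDatum L 2 (Matrix.of fun i j : Fin 2 => if i.val + j.val + 1 = 2 then (1 : L) else 0)).Local v × (cmDatum L 1 (Matrix.of fun i j : Fin 1 => if i.val + j.val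 + 1 = 1 then (1 : L) else 0)).Local v)) : Set ((cmDatum L 2 (Matrix.of fun i j : Fin 2 => if i.val + j.val + 1 = 2 then (1 : L) else 0)).Local v × (cmDatum L 1 (Matrix.of fun i j : Fin 1 => if i.val + j.val + 1 = 1 then (1 : L) else 0)).Local v)), f (k⁻¹ * ND i t * k) ∂ν)) =
          ∑ i ∈ Finset.range (j + R + 1), (2 * (q : ℂ) ^ i) * ((∫ k in ((K.prod (⊤ : Subgroup ((cmDatum L 1 (Matrix.of fun i j : Fin 1 => if i.val + j.val + 1 = 1 then (1 : L) else 0)).Local v)) : Subgroup ((cmDatum L 2 (Matrix.of fun i j : Fin 2 => if i.val + j.val + 1 = 2 then (1 : L) else 0)).Local v × (cmDatum L 1 (Matrix.of fun i j : Fin 1 => if i.val + j.val + 1 = 1 then (1 : L) else 0)).Local v)) : Set ((cmDatum L 2 (Matrix.of fun i j : Fin 2 => if i.val + j.val + 1 = 2 then (1 : L) else 0)).Local v × (cmDatum L 1 (Matrix.of fun i j : Fin 1 => if i.val + j.val + 1 = 1 then (1 : L) else 0)).Local v)), f (k⁻¹ * N i s * k) ∂ν) - ∫ k in ((K.prod (⊤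 : Subgroup ((cmDatum L 1 (Matrix.of fun i j : Fin 1 => if i.val + j.val + 1 = 1 then (1 : L) else 0)).Local v)) : Subgroup ((cmDatum L 2 (Matrix.of fun i j : Fin 2 => if i.val + j.val + 1 = 2 then (1 : L) else 0)).Local v × (cmDatum L 1 (Matrix.of fun i j : Fin 1 => if i.val + j.val + 1 = 1 then (1 : L) else 0)).Local v)) : Set ((cmDatum L 2 (Matrix.of fun i j : Fin 2 => if i.val + j.val + 1 = 2 then (1 : L) else 0)).Local v × (cmDatum L 1 (Matrix.of fun i j : Fin 1 => if i.val + j.val + 1 = 1 then (1 : L) else 0)).Local v)), f (k⁻¹ * ND i s * k) ∂ν) :=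
  fun s hs => eventually_mem_imp_shellWindow_eq_of_continuousAt ν hf.1 hKc hKm q j R (fun i hi => hN i hi s hs) (fun i hi => hND i hi s hs) _

/-- Families continuous on all of `Z(t₀)`: `W` is LOCALLY CONSTANT on the torus (singular points included), hence `hW` at once.
[cite: LabesseLanglands1979, §2 p. 9] [cite: Labesse2024StabilisationGermesSL2, Th. 0.0.12] -/
theorem isLocallyConstant_wildWindow
    [MeasurableSpace ((cmDatum L 2 (Matrix.of fun i j : Fin 2 => if i.val + j.val + 1 = 2 then (1 : L) else 0)).Local v × (cmDatum L 1 (Matrix.of fun i j : Fin 1 => if i.val + j.val + 1 = 1 then (1 : L) else 0)).Local v)] [BorelSpace ((cmDatum L 2 (Matrix.of fun i j : Fin 2 => if i.val + j.val + 1 = 2 then (1 : L) else 0)).Local v × (cmDatum L 1 (Matrix.of fun i j : Fin 1 => if i.val + j.val + 1 = 1 then (1 : L) else 0)).Local v)] (ν : Measure ((cmDatum L 2 (Matrix.of fun i j : Fin 2 => if i.val + j.val + 1 = 2 then (1 : L) else 0)).Local v × (cmDatum L 1 (Matrix.of fun i j : Fin 1 => if i.val + j.val + 1 = 1 then (1 :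 L) else 0)).Local v))
    (f : ((cmDatum L 2 (Matrix.of fun i j : Fin 2 => if i.val + j.val + 1 = 2 then (1 : L) else 0)).Local v × (cmDatum L 1 (Matrix.of fun i j : Fin 1 => if i.val + j.val + 1 = 1 then (1 : L) else 0)).Local v) → ℂ) (hf : IsLocSmooth f) (t₀ : ((cmDatum L 2 (Matrix.of fun i j : Fin 2 => if i.val + j.val + 1 = 2 then (1 : L) else 0)).Local v × (cmDatum L 1 (Matrix.of fun i j : Fin 1 => if i.val + j.val + 1 = 1 then (1 : L) else 0)).Local v))
    (K : Subgroup ((cmDatum L 2 (Matrix.of fun i j : Fin 2 => if i.val + j.val + 1 = 2 then (1 : L) else 0)).Local v))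
    (hKc : IsCompact ((K.prod (⊤ : Subgroup ((cmDatum L 1 (Matrix.of fun i j : Fin 1 => if i.val + j.val + 1 = 1 then (1 : L) else 0)).Local v)) : Subgroup ((cmDatum L 2 (Matrix.of fun i j : Fin 2 => if i.val + j.val + 1 = 2 then (1 : L) else 0)).Local v × (cmDatum L 1 (Matrix.of fun i j : Fin 1 => if i.val + j.val + 1 = 1 then (1 : L) else 0)).Local v)) : Set ((cmDatum L 2 (Matrix.of fun i j : Fin 2 => if i.val + j.val + 1 = 2 then (1 : L) else 0)).Local v × (cmDatum L 1 (Matrix.of fun i j : Fin 1 => if i.val + j.val + 1 = 1 then (1 : L) else 0)).Local v)))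
    (hKm : MeasurableSet ((K.prod (⊤ : Subgroup ((cmDatum L 1 (Matrix.of fun i j : Fin 1 => if i.val + j.val + 1 = 1 then (1 : L) else 0)).Local v)) : Subgroup ((cmDatum L 2 (Matrix.of fun i j : Fin 2 => if i.val + j.val + 1 = 2 then (1 : L) else 0)).Local v × (cmDatum L 1 (Matrix.of fun i j : Fin 1 => if i.val + j.val + 1 = 1 then (1 : L) else 0)).Local v)) : Set ((cmDatum L 2 (Matrix.of fun i j : Fin 2 => if i.val + j.val + 1 = 2 then (1 : L) else 0)).Local v × (cmDatum L 1 (Matrix.of fun i j : Fin 1 => if i.val + j.val + 1 = 1 then (1 : L) else 0)).Local v)))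
    (q j R : ℕ) (N ND : ℕ → ↥(Subgroup.centralizer ({t₀} : Set ((cmDatum L 2 (Matrix.of fun i j : Fin 2 => if i.val + j.val + 1 = 2 then (1 : L) else 0)).Local v × (cmDatum L 1 (Matrix.of fun i j : Fin 1 => if i.val + j.val + 1 = 1 then (1 : L) else 0)).Local v))) → ((cmDatum L 2 (Matrix.of fun i j : Fin 2 => if i.val + j.val + 1 = 2 then (1 : L) else 0)).Local v × (cmDatum L 1 (Matrix.of fun i j : Fin 1 => if i.val + j.val + 1 = 1 then (1 : L) else 0)).Local v))
    (hN : ∀ i ∈ Finset.range (j + R + 1), Continuous (N i)) (hND : ∀ i ∈ Finset.range (j + R + 1), Continuous (ND i)) :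
    IsLocallyConstant fun t : ↥(Subgroup.centralizer ({t₀} : Set ((cmDatum L 2 (Matrix.of fun i j : Fin 2 => if i.val + j.val + 1 = 2 then (1 : L) else 0)).Local v × (cmDatum L 1 (Matrix.of fun i j : Fin 1 => if i.val + j.val + 1 = 1 then (1 : L) else 0)).Local v))) =>
      ∑ i ∈ Finset.range (j + R + 1), (2 * (q : ℂ) ^ i) * ((∫ k in ((K.prod (⊤ : Subgroup ((cmDatum L 1 (Matrix.of fun i j : Fin 1 => if i.val + j.val + 1 = 1 then (1 : L) else 0)).Local v)) : Subgroup ((cmDatum L 2 (Matrix.of fun i j : Fin 2 => if i.val + j.val + 1 = 2 then (1 : L) else 0)).Local v × (cmDatum L 1 (Matrix.of fun i j : Fin 1 => if i.val + j.val + 1 = 1 then (1 : L) else 0)).Local v)) : Set ((cmDatum L 2 (Matrix.of fun i j : Fin 2 => if i.val + j.val + 1 = 2 then (1 : L) else 0)).Local v × (cmDatum L 1 (Matrix.of fun i j : Fin 1 => if i.val + j.val + 1 = 1 then (1 : L) else 0)).Local v)), f (k⁻¹ * N i t * k) ∂ν) - ∫ k in ((K.prod (⊤ : Subgroup ((cmDatum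 L 1 (Matrix.of fun i j : Fin 1 => if i.val + j.val + 1 = 1 then (1 : L) else 0)).Local v)) : Subgroup ((cmDatum L 2 (Matrix.of fun i j : Fin 2 => if i.val + j.val + 1 = 2 then (1 : L) else 0)).Local v × (cmDatum L 1 (Matrix.of fun i j : Fin 1 => if i.val + j.val + 1 = 1 then (1 : L) else 0)).Local v)) : Set ((cmDatum L 2 (Matrix.of fun i j : Fin 2 => if i.val + j.val + 1 = 2 then (1 : L) else 0)).Local v × (cmDatum L 1 (Matrix.of fun i j : Fin 1 => if i.val + j.val + 1 = 1 then (1 : L) else 0)).Local v)), f (k⁻¹ * ND i t * k) ∂ν) :=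
  isLocallyConstant_shellWindow ν hf.1 hKc hKm q j R hN hND

/-- `hW` from globally continuous families (corollary of `isLocallyConstant_wildWindow`). [cite: LabesseLanglands1979, §2 p. 9] -/
theorem wildWindow_eventually_eq_of_continuous
    [MeasurableSpace ((cmDatum L 2 (Matrix.of fun i j : Fin 2 => if i.val + j.val + 1 = 2 then (1 : L) else 0)).Local v × (cmDatum L 1 (Matrix.of fun i j : Fin 1 => if i.val + j.val + 1 = 1 then (1 : L) else 0)).Local v)] [BorelSpace ((cmDatum L 2 (Matrix.of fun i j : Fin 2 => if i.val + j.val + 1 = 2 then (1 : L) else 0)).Local v × (cmDatum L 1 (Matrix.of fun i j : Fin 1 => if i.val + j.val + 1 = 1 then (1 : L) else 0)).Local v)] (ν : Measure ((cmDatum L 2 (Matrix.of fun i j : Fin 2 => if i.val + j.val + 1 = 2 then (1 : L) else 0)).Local v × (cmDatum L 1 (Matrix.of fun i j : Fin 1 => if i.val + j.val + 1 = 1 then (1 : L) else 0)).Local v))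
    (f : ((cmDatum L 2 (Matrix.of fun i j : Fin 2 => if i.val + j.val + 1 = 2 then (1 : L) else 0)).Local v × (cmDatum L 1 (Matrix.of fun i j : Fin 1 => if i.val + j.val + 1 = 1 then (1 : L) else 0)).Local v) → ℂ) (hf : IsLocSmooth f) (t₀ : ((cmDatum L 2 (Matrix.of fun i j : Fin 2 => if i.val + j.val + 1 = 2 then (1 : L) else 0)).Local v × (cmDatum L 1 (Matrix.of fun i j : Fin 1 => if i.val + j.val + 1 = 1 then (1 : L) else 0)).Local v))
    (K : Subgroup ((cmDatum L 2 (Matrix.of fun i j : Fin 2 => if i.val + j.val + 1 = 2 then (1 : L) else 0)).Local v))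
    (hKc : IsCompact ((K.prod (⊤ : Subgroup ((cmDatum L 1 (Matrix.of fun i j : Fin 1 => if i.val + j.val + 1 = 1 then (1 : L) else 0)).Local v)) : Subgroup ((cmDatum L 2 (Matrix.of fun i j : Fin 2 => if i.val + j.val + 1 = 2 then (1 : L) else 0)).Local v × (cmDatum L 1 (Matrix.of fun i j : Fin 1 => if i.val + j.val + 1 = 1 then (1 : L) else 0)).Local v)) : Set ((cmDatum L 2 (Matrix.of fun i j : Fin 2 => if i.val + j.val + 1 = 2 then (1 : L) else 0)).Local v × (cmDatum L 1 (Matrix.of fun i j : Fin 1 => if i.val + j.val + 1 = 1 then (1 : L) else 0)).Local v)))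
    (hKm : MeasurableSet ((K.prod (⊤ : Subgroup ((cmDatum L 1 (Matrix.of fun i j : Fin 1 => if i.val + j.val + 1 = 1 then (1 : L) else 0)).Local v)) : Subgroup ((cmDatum L 2 (Matrix.of fun i j : Fin 2 => if i.val + j.val + 1 = 2 then (1 : L) else 0)).Local v × (cmDatum L 1 (Matrix.of fun i j : Fin 1 => if i.val + j.val + 1 = 1 then (1 : L) else 0)).Local v)) : Set ((cmDatum L 2 (Matrix.of fun i j : Fin 2 => if i.val + j.val + 1 = 2 then (1 : L) else 0)).Local v × (cmDatum L 1 (Matrix.of fun i j : Fin 1 => if i.val + j.val + 1 = 1 then (1 : L) else 0)).Local v)))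
    (q j R : ℕ) (N ND : ℕ → ↥(Subgroup.centralizer ({t₀} : Set ((cmDatum L 2 (Matrix.of fun i j : Fin 2 => if i.val + j.val + 1 = 2 then (1 : L) else 0)).Local v × (cmDatum L 1 (Matrix.of fun i j : Fin 1 => if i.val + j.val + 1 = 1 then (1 : L) else 0)).Local v))) → ((cmDatum L 2 (Matrix.of fun i j : Fin 2 => if i.val + j.val + 1 = 2 then (1 : L) else 0)).Local v × (cmDatum L 1 (Matrix.of fun i j : Fin 1 => if i.val + j.val + 1 = 1 then (1 : L) else 0)).Local v))
    (hN : ∀ i ∈ Finset.range (j + R + 1), Continuous (N i)) (hND : ∀ i ∈ Finset.range (j + R + 1), Continuous (ND i)) :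
    ∀ s : ↥(Subgroup.centralizer ({t₀} : Set ((cmDatum L 2 (Matrix.of fun i j : Fin 2 => if i.val + j.val + 1 = 2 then (1 : L) else 0)).Local v × (cmDatum L 1 (Matrix.of fun i j : Fin 1 => if i.val + j.val + 1 = 1 then (1 : L) else 0)).Local v))), ¬ IsRegularElt ((s : ((cmDatum L 2 (Matrix.of fun i j : Fin 2 => if i.val + j.val + 1 = 2 then (1 : L) else 0)).Local v × (cmDatum L 1 (Matrix.of fun i j : Fin 1 => if i.val + j.val + 1 = 1 then (1 : L) else 0)).Local v)).1.val : GL (Fin 2) (LocalRing L v)) →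
      ∀ᶠ (t : ↥(Subgroup.centralizer ({t₀} : Set ((cmDatum L 2 (Matrix.of fun i j : Fin 2 => if i.val + j.val + 1 = 2 then (1 : L) else 0)).Local v × (cmDatum L 1 (Matrix.of fun i j : Fin 1 => if i.val + j.val + 1 = 1 then (1 : L) else 0)).Local v)))) in 𝓝 s, t ∈ {t : ↥(Subgroup.centralizer ({t₀} : Set ((cmDatum L 2 (Matrix.of fun i j : Fin 2 => if i.val + j.val + 1 = 2 then (1 : L) else 0)).Local v × (cmDatum L 1 (Matrix.of fun i j : Fin 1 => if i.val + j.val + 1 = 1 then (1 : L) else 0)).Local v))) | IsRegularElt ((t : ((cmDatum L 2 (Matrix.of fun i j : Fin 2 => if i.val + j.val + 1 = 2 then (1 : L) else 0)).Local v × (cmDatum L 1 (Matrix.of fun i j : Fin 1 => if i.val + j.val + 1 = 1 then (1 : L) else 0)).Local v)).1.val : GL (Fin 2) (LocalRing L v))} →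
        (∑ i ∈ Finset.range (j + R + 1), (2 * (q : ℂ) ^ i) * ((∫ k in ((K.prod (⊤ : Subgroup ((cmDatum L 1 (Matrix.of fun i j : Fin 1 => if i.val + j.val + 1 = 1 then (1 : L) else 0)).Local v)) : Subgroup ((cmDatum L 2 (Matrix.of fun i j : Fin 2 => if i.val + j.val + 1 = 2 then (1 : L) else 0)).Local v × (cmDatum L 1 (Matrix.of fun i j : Fin 1 => if i.val + j.val + 1 = 1 then (1 : L) else 0)).Local v)) : Set ((cmDatum L 2 (Matrix.of fun i j : Fin 2 => if i.val + j.val + 1 = 2 then (1 : L) else 0)).Local v × (cmDatum L 1 (Matrix.of fun i j : Fin 1 => if i.val + j.val + 1 = 1 then (1 : L) else 0)).Local v)), f (k⁻¹ * N i t * k) ∂ν) - ∫ k in ((K.prod (⊤ : Subgroup ((cmDatum L 1 (Matrix.of fun i j : Fin 1 => if i.val + j.val + 1 = 1 then (1 : L) else 0)).Local v)) : Subgroup ((cmDatum L 2 (Matrix.of fun i j : Fin 2 => if i.val + j.val + 1 = 2 then (1 : L) else 0)).Local v × (cmDatum L 1 (Matrix.of fun i j : Fin 1 => if i.val + j.val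 + 1 = 1 then (1 : L) else 0)).Local v)) : Set ((cmDatum L 2 (Matrix.of fun i j : Fin 2 => if i.val + j.val + 1 = 2 then (1 : L) else 0)).Local v × (cmDatum L 1 (Matrix.of fun i j : Fin 1 => if i.val + j.val + 1 = 1 then (1 : L) else 0)).Local v)), f (k⁻¹ * ND i t * k) ∂ν)) =
          ∑ i ∈ Finset.range (j + R + 1), (2 * (q : ℂ) ^ i) * ((∫ k in ((K.prod (⊤ : Subgroup ((cmDatum L 1 (Matrix.of fun i j : Fin 1 => if i.val + j.val + 1 = 1 then (1 : L) else 0)).Local v)) : Subgroup ((cmDatum L 2 (Matrix.of fun i j : Fin 2 => if i.val + j.val + 1 = 2 then (1 : L) else 0)).Local v × (cmDatum L 1 (Matrix.of fun i j : Fin 1 => if i.val + j.val + 1 = 1 then (1 : L) else 0)).Local v)) : Set ((cmDatum L 2 (Matrix.of fun i j : Fin 2 => if i.val + j.val + 1 = 2 then (1 : L) else 0)).Local v × (cmDatum L 1 (Matrix.of fun i j : Fin 1 => if i.val + j.val + 1 = 1 then (1 : L) else 0)).Local v)), f (k⁻¹ * N i s * k) ∂ν) - ∫ k in ((K.prod (⊤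 : Subgroup ((cmDatum L 1 (Matrix.of fun i j : Fin 1 => if i.val + j.val + 1 = 1 then (1 : L) else 0)).Local v)) : Subgroup ((cmDatum L 2 (Matrix.of fun i j : Fin 2 => if i.val + j.val + 1 = 2 then (1 : L) else 0)).Local v × (cmDatum L 1 (Matrix.of fun i j : Fin 1 => if i.val + j.val + 1 = 1 then (1 : L) else 0)).Local v)) : Set ((cmDatum L 2 (Matrix.of fun i j : Fin 2 => if i.val + j.val + 1 = 2 then (1 : L) else 0)).Local v × (cmDatum L 1 (Matrix.of fun i j : Fin 1 => if i.val + j.val + 1 = 1 then (1 : L) else 0)).Local v)), f (k⁻¹ * ND i s * k) ∂ν) :=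
  fun s _ => ((isLocallyConstant_wildWindow L v ν f hf t₀ K hKc hKm q j R N ND hN hND).eventually_eq s).mono fun _ h _ => h

end Layer

end Literature.NumberTheory.Rogawski1990

end
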